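import Summits.QuantumFields.YangMills.Theorems.BalabanUVNodesN21ShellSplitOfRecord13CoPHDefs
import Summits.QuantumFields.YangMills.Theorems.BalabanUVNodesSpineReadingOfRecord13CoPHChi

/-!
# N21 THRESHOLD SHELLS — THE KEYED SHELL SPLIT OF RECORD, χ-GENERIC («Cmap» ∕ Chi EDITION): `shellA₁₃Chi ∕ shellB₁₃Chi`, the letter TYPE `WidthLetter₁₃CoPHCmap N Χ`, the
# reading `shellSplitOfRecord₁₃AtCmap Χ K₀ ρA ρB : ShellSplit₁₃CoPHCmap N Χ K₀` — §3 of `Thm/BalabanUVNodesN21ShellSplitOfRecord13CoPHDefs` (dag-n21) RE-ISSUED over the β-slot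
# (plan g99 census row 7), with the receipts at `χ := chiβOfRecord₁₃ θ` (`rfl`) and the RE-CENTRED instances `…Ax`

Cell `pub-ymgap`, YM-PLAN Track A (HUMAN RULING D-0062); seat `pub-ymgap-dag-n15-a` (g38) — op 5c (a) T4 of HANDS-4 (dag-lead g40 WORDS 591; g41 WORDS 610 (4) T4 REBALANCE:
dag-n15-c silent ⇒ n15-a files the three T4 basenames), supply for K3ᴬ `SpineGivenEndpointR13SepCoPHVAx` (stmt-QuantumFields-27247; plan g99 memo `OP5C-SUPPLY-CENSUS-K3v8.md`
§2 rows 6–8 ∕ §3 ∕ σ4–σ5; node00-def-RR-2 GATE-0 Q-TRANSPORT = NO, I.21769).  `--kind definition --supports stmt-QuantumFields-27247 --as helper`; COUNT-NEUTRAL.  NOTHING of record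
is edited (body-freeze; NEW basename beside the untouched parent): every declaration below is the VERBATIM body of the like-named parent declaration with exactly the substitutions
of T3 `…SpineReadingOfRecord13CoPHChi` (dag-n20-d ✓p806069): `(hP : θ.Provisos₁₃CoPH F N) ↦ (χ : ChiSlot F N) (hP : θ.Provisos₁₃CoPHChi F N χ)`, `histA∕B₁₃ θ ↦ histA∕B₁₃Chi θ χ`,
`keyA∕B₁₃ θ ↦ keyA∕B₁₃Chi θ χ`, `classSet₁₃ ∕ badClass₁₃ θ ↦ …Chi θ χ`, `datumOfRecord₁₃CoPH θ hP ↦ datumOfRecord₁₃CoPHChi θ χ hP`; names `X₁₃ ↦ X₁₃Chi` (θ-level, slot `χ`) ∕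
`XCmap` (family-level, slot READING `Χ : (F : T4Family) → Stage13Params F N → ChiSlot F N`, read at `Χ F θ.toStage13Params`; letter TYPES `…Letter₁₃CoPHCmap N Χ`, readings
`ShellSplit₁₃CoPHCmap N Χ K₀` ∕ `SpineReading₁₃CoPHCmap N Χ` ∕ `crOfRecord₁₃AtCmap Χ …` from T2∕T3 BY NAME, not re-declared); receipts at the record's own slot `χ := chiβOfRecord₁₃ θ` (`rfl`,
provisos transported through `provisos₁₃CoPHChi_chiβ_iff`); RE-CENTRED instances `abbrev XAx := X… (chiβOfRecord₁₃Ax …)`.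

WHAT IS DEFINED ∕ PROVED (definitions + `rfl` bookkeeping; zero `sorry`).  §3χ `shellA₁₃Chi ∕ shellB₁₃Chi` (θ-level keyed shell parts at the χ-datum along T3's χ-keys) · the TYPE
`WidthLetter₁₃CoPHCmap N Χ` · `shellSplitOfRecord₁₃AtCmap Χ K₀ ρA ρB : ShellSplit₁₃CoPHCmap N Χ K₀` (+ `_fst ∕ _snd`, `crOfRecord₁₃AtCmap_shellSplit_shA ∕ _shB`, all `rfl`) · §R receipts
`shellA∕B₁₃Chi_chiβ`, `shellSplitOfRecord₁₃AtCmap_chiβ` · §A `WidthLetter₁₃CoPHAx`, `shellA∕B₁₃Ax`, `shellSplitOfRecord₁₃AtAx : ShellSplit₁₃CoPHAx N K₀`.  The parent's §1∕§2∕§4∕§5 (cube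
indicators, term shell parts `shellWeightOfDatum₉ ∕ shellPieceOfDatum₉ ∕ cubeWeightOfDatum₉`, block fibre laws) are DATUM-GENERIC (χ-free) and USED BY NAME.

HONEST FRAMING.  DEFINITIONS re-issued over a parameter + `rfl` bookkeeping; NO estimate; nothing of Bałaban's asserted, ported or discharged; no `Provisos₁₃CoPHChi ∕ …Ax`
inhabitant claimed (K0 open); K-Ax cruxes 3∕3 OPEN; N21 ∕ N19 ∕ N27 NOT discharged; N15's record untouched; counts UNMOVED (typed 28∕28 · discharged 8∕27); one finite four-torus
programme at fixed `ε` — NOT ℝ⁴, NOT OS, NOT a mass gap, NOT the Clay problem.  No `instance`, no `notation`, no `sorry`, no `axiom`; no decl below carries a cite tag.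
-/

noncomputable section

open scoped BigOperators
open Finset MeasureTheory

namespace Summit.QuantumFields.YangMills.Theorems.N21ShellSplitOfRecord13CoPH

open Literature.MathematicalPhysics.QuantumFieldTheory.Balaban1983to89
open Literature.MathematicalPhysics.QuantumFieldTheory.Balaban1983to89.T4Continuum
open Literature.MathematicalPhysics.QuantumFieldTheory.Balaban1983to89.Node00
open YMDAG.UVSplit (crOfRecord₁₃At ShellSplit₁₃CoPH keyA₁₃ keyB₁₃ runA₁₃ runB₁₃ histA₁₃ histB₁₃
  crOfRecord₁₃AtCmap ShellSplit₁₃CoPHCmap ShellSplit₁₃CoPHAx keyA₁₃Chi keyB₁₃Chi histA₁₃Chi histB₁₃Chi)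

/-! ## §3χ The keyed shell split at the χ-keyed Stage-13 record -/

section Keyed

variable {F : T4Family} {N : ℕ} [NeZero N]
  {Χ : (F : T4Family) → Stage13Params F N → ChiSlot F N}

/-- **RUN A's KEYED SHELL PART OF RECORD** (comparison `K`, level `K₀ + K`, relative widths `ρ K`): the fibre sum, along n20-d's key of record `keyA₁₃Chi`, of the
term shell parts of the tuple's own dressed family at its own datum. [bookkeeping] -/
def shellA₁₃Chi (θ : Stage13HParams F N) (χ : ChiSlot F N) (hP : θ.Provisos₁₃CoPHChi F N χ) (K₀ : ℕ) (g₀ : ℕ → ℝ) (os : List (ULoop F)) (ρ : ℕ → ℝ)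
    (K : ℕ) (t : ℝ) (x : Σ K, SiteSeqKey F (K₀ + K)) : ℝ :=
  letI : ∀ Kc, DecidableEq (SiteSeqKey F Kc) := fun _ => Classical.decEq _
  ∑ s ∈ univ.filter (fun s => keyA₁₃Chi θ χ K₀ g₀ K s = x),
    shellWeightOfDatum₉ F N θ.toStage9Params (datumOfRecord₁₃CoPHChi F N θ χ hP) g₀ os (runA₁₃ F K₀ g₀ K) (histA₁₃Chi θ χ K₀ g₀ K) (K₀ + K) (ρ K) t s

/-- **RUN B's KEYED SHELL PART OF RECORD** (comparison `K`, level `K₀ + K + 1`, along `keyB₁₃Chi`). [bookkeeping] -/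
def shellB₁₃Chi (θ : Stage13HParams F N) (χ : ChiSlot F N) (hP : θ.Provisos₁₃CoPHChi F N χ) (K₀ : ℕ) (g₀ : ℕ → ℝ) (os : List (ULoop F)) (ρ : ℕ → ℝ)
    (K : ℕ) (t : ℝ) (x : Σ K, SiteSeqKey F (K₀ + K)) : ℝ :=
  letI : ∀ Kc, DecidableEq (SiteSeqKey F Kc) := fun _ => Classical.decEq _
  ∑ s' ∈ univ.filter (fun s' => keyB₁₃Chi θ χ K₀ g₀ K s' = x),
    shellWeightOfDatum₉ F N θ.toStage9Params (datumOfRecord₁₃CoPHChi F N θ χ hP) g₀ os (runB₁₃ F K₀ g₀ K) (histB₁₃Chi θ χ K₀ g₀ K) (K₀ + K + 1) (ρ K) t s'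

variable (N) in
/-- **WIDTH LETTERS**: a relative shell width per tuple and comparison index (N16's two-run closeness ∕ the consumer's choice; a LETTER here). [bookkeeping] -/
abbrev WidthLetter₁₃CoPHCmap (Χ : (F : T4Family) → Stage13Params F N → ChiSlot F N) : Type 1 :=
  (F : T4Family) → (θ : Stage13HParams F N) → θ.Provisos₁₃CoPHChi F N (Χ F θ.toStage13Params) → (ℕ → ℝ) → List (ULoop F) → ℕ → ℝ

variable (Χ) in
/-- ★ **THE SHELL SPLIT OF RECORD AT OFFSET `K₀`** with width letters `ρA ∕ ρB`: the pair `(shellA₁₃Chi, shellB₁₃Chi)` at every tuple — an INHABITANT of n20-d's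
`ShellSplit₁₃CoPHCmap N Χ K₀`, the one residual reading of `crOfRecord₁₃AtCmap`. [bookkeeping] -/
def shellSplitOfRecord₁₃AtCmap (K₀ : ℕ) (ρA ρB : WidthLetter₁₃CoPHCmap N Χ) : ShellSplit₁₃CoPHCmap N Χ K₀ := fun F θ hP g₀ os =>
  (shellA₁₃Chi θ (Χ F θ.toStage13Params) hP K₀ g₀ os (ρA F θ hP g₀ os), shellB₁₃Chi θ (Χ F θ.toStage13Params) hP K₀ g₀ os (ρB F θ hP g₀ os))

/-- Dictionary: the split's first component is `shellA₁₃Chi`. [bookkeeping] -/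
@[simp] theorem shellSplitOfRecord₁₃AtCmap_fst (K₀ : ℕ) (ρA ρB : WidthLetter₁₃CoPHCmap N Χ) (F : T4Family) (θ : Stage13HParams F N)
    (hP : θ.Provisos₁₃CoPHChi F N (Χ F θ.toStage13Params)) (g₀ : ℕ → ℝ) (os : List (ULoop F)) :
    (shellSplitOfRecord₁₃AtCmap Χ K₀ ρA ρB F θ hP g₀ os).1 = shellA₁₃Chi θ (Χ F θ.toStage13Params) hP K₀ g₀ os (ρA F θ hP g₀ os) := rfl

/-- Dictionary: the split's second component is `shellB₁₃Chi`. [bookkeeping] -/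
@[simp] theorem shellSplitOfRecord₁₃AtCmap_snd (K₀ : ℕ) (ρA ρB : WidthLetter₁₃CoPHCmap N Χ) (F : T4Family) (θ : Stage13HParams F N)
    (hP : θ.Provisos₁₃CoPHChi F N (Χ F θ.toStage13Params)) (g₀ : ℕ → ℝ) (os : List (ULoop F)) :
    (shellSplitOfRecord₁₃AtCmap Χ K₀ ρA ρB F θ hP g₀ os).2 = shellB₁₃Chi θ (Χ F θ.toStage13Params) hP K₀ g₀ os (ρB F θ hP g₀ os) := rfl

/-- ★ Dictionary: the `shA` of the spine reading of record at this split is run A's keyed shell part of record (`rfl`). [bookkeeping] -/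
theorem crOfRecord₁₃AtCmap_shellSplit_shA (K₀ : ℕ) (jcut : ℕ → ℕ) (ρA ρB : WidthLetter₁₃CoPHCmap N Χ) (F : T4Family) (θ : Stage13HParams F N)
    (hP : θ.Provisos₁₃CoPHChi F N (Χ F θ.toStage13Params)) (g₀ : ℕ → ℝ) (os : List (ULoop F)) :
    (crOfRecord₁₃AtCmap Χ K₀ jcut (shellSplitOfRecord₁₃AtCmap Χ K₀ ρA ρB) F θ hP g₀ os).shA = shellA₁₃Chi θ (Χ F θ.toStage13Params) hP K₀ g₀ os (ρA F θ hP g₀ os) := rfl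

/-- ★ Dictionary: the `shB` of the spine reading of record at this split is run B's keyed shell part of record (`rfl`). [bookkeeping] -/
theorem crOfRecord₁₃AtCmap_shellSplit_shB (K₀ : ℕ) (jcut : ℕ → ℕ) (ρA ρB : WidthLetter₁₃CoPHCmap N Χ) (F : T4Family) (θ : Stage13HParams F N)
    (hP : θ.Provisos₁₃CoPHChi F N (Χ F θ.toStage13Params)) (g₀ : ℕ → ℝ) (os : List (ULoop F)) :
    (crOfRecord₁₃AtCmap Χ K₀ jcut (shellSplitOfRecord₁₃AtCmap Χ K₀ ρA ρB) F θ hP g₀ os).shB = shellB₁₃Chi θ (Χ F θ.toStage13Params) hP K₀ g₀ os (ρB F θ hP g₀ os) := rfl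

end Keyed

/-! ## §R Receipts at the record's own β-slot `χ := chiβOfRecord₁₃ θ` (definitional) -/

section Receipts

variable {F : T4Family} {N : ℕ} [NeZero N] (θ : Stage13HParams F N) (hP : θ.Provisos₁₃CoPHChi F N (chiβOfRecord₁₃ F N θ.toStage13Params)) (K₀ : ℕ) (g₀ : ℕ → ℝ)
  (os : List (ULoop F)) (ρ : ℕ → ℝ)

/-- Receipt: run A's χ-keyed shell part at the record's β-slot IS `shellA₁₃` (provisos through `provisos₁₃CoPHChi_chiβ_iff`). [bookkeeping] -/
theorem shellA₁₃Chi_chiβ : shellA₁₃Chi θ (chiβOfRecord₁₃ F N θ.toStage13Params) hP K₀ g₀ os ρ = shellA₁₃ θ ((provisos₁₃CoPHChi_chiβ_iff θ).1 hP) K₀ g₀ os ρ := rfl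

/-- Receipt: run B's χ-keyed shell part at the record's β-slot IS `shellB₁₃`. [bookkeeping] -/
theorem shellB₁₃Chi_chiβ : shellB₁₃Chi θ (chiβOfRecord₁₃ F N θ.toStage13Params) hP K₀ g₀ os ρ = shellB₁₃ θ ((provisos₁₃CoPHChi_chiβ_iff θ).1 hP) K₀ g₀ os ρ := rfl

/-- Receipt: the χ-shell split at `Χ := chiβOfRecord₁₃` IS `shellSplitOfRecord₁₃At` at the transported provisos and the width letters read back through them. [bookkeeping] -/
theorem shellSplitOfRecord₁₃AtCmap_chiβ (ρA ρB : WidthLetter₁₃CoPH N) :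
    shellSplitOfRecord₁₃AtCmap (fun F => chiβOfRecord₁₃ F N) K₀ (fun F θ h g₀ os => ρA F θ ((provisos₁₃CoPHChi_chiβ_iff θ).1 h) g₀ os)
        (fun F θ h g₀ os => ρB F θ ((provisos₁₃CoPHChi_chiβ_iff θ).1 h) g₀ os) F θ hP g₀ os =
      shellSplitOfRecord₁₃At N K₀ ρA ρB F θ ((provisos₁₃CoPHChi_chiβ_iff θ).1 hP) g₀ os := rfl

end Receipts

/-! ## §A The RE-CENTRED instances (`χ := chiβOfRecord₁₃Ax θ`) -/

section Ax

variable {F : T4Family} {N : ℕ} [NeZero N]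

/-- Run A's keyed shell part of record, RE-CENTRED (binder `θ.Provisos₁₃CoPHAx F N`). [bookkeeping] -/
abbrev shellA₁₃Ax (θ : Stage13HParams F N) (hP : θ.Provisos₁₃CoPHAx F N) (K₀ : ℕ) (g₀ : ℕ → ℝ) (os : List (ULoop F)) (ρ : ℕ → ℝ)
    (K : ℕ) (t : ℝ) (x : Σ K, SiteSeqKey F (K₀ + K)) : ℝ :=
  shellA₁₃Chi θ (chiβOfRecord₁₃Ax F N θ.toStage13Params) hP K₀ g₀ os ρ K t x

/-- Run B's keyed shell part of record, RE-CENTRED. [bookkeeping] -/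
abbrev shellB₁₃Ax (θ : Stage13HParams F N) (hP : θ.Provisos₁₃CoPHAx F N) (K₀ : ℕ) (g₀ : ℕ → ℝ) (os : List (ULoop F)) (ρ : ℕ → ℝ)
    (K : ℕ) (t : ℝ) (x : Σ K, SiteSeqKey F (K₀ + K)) : ℝ :=
  shellB₁₃Chi θ (chiβOfRecord₁₃Ax F N θ.toStage13Params) hP K₀ g₀ os ρ K t x

variable (N) in
/-- The width-letter TYPE, RE-CENTRED (the K3ᴬ v8 `DialRows (ρ ρ' : …)` binder). [bookkeeping] -/
abbrev WidthLetter₁₃CoPHAx : Type 1 := WidthLetter₁₃CoPHCmap N (fun F => chiβOfRecord₁₃Ax F N)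

/-- The keyed shell split of record at offset `K₀`, RE-CENTRED. [bookkeeping] -/
abbrev shellSplitOfRecord₁₃AtAx (K₀ : ℕ) (ρA ρB : WidthLetter₁₃CoPHAx N) : ShellSplit₁₃CoPHAx N K₀ :=
  shellSplitOfRecord₁₃AtCmap (fun F => chiβOfRecord₁₃Ax F N) K₀ ρA ρB

end Ax

end Summit.QuantumFields.YangMills.Theorems.N21ShellSplitOfRecord13CoPH

end
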